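import Literature.AlgebraicGeometry.AbelianSchemes.AbelianSchemeKOfL
import Literature.AlgebraicGeometry.AbelianSchemes.PoincareFamilyPointsInjective
import Literature.AlgebraicGeometry.AbelianSchemes.AbelianSchemeSmallExtensionPicardTorsor
import Literature.AlgebraicGeometry.AbelianSchemes.MumfordQuotientSliceInjective
import Literature.AlgebraicGeometry.AbelianSchemes.GraphPointResidueField
import Literature.AlgebraicGeometry.AbelianSchemes.PoincareFamilyKSSurjective
import Literature.AlgebraicGeometry.Deformation.MorphismLiftsSquareZeroSmoothLocal
import Literature.AlgebraicGeometry.AbelianSchemes.AbelianSchemeDualPairNormalize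
import Literature.AlgebraicGeometry.AbelianSchemes.AbelianSchemeDualIsogenyComp
import Literature.AlgebraicGeometry.Modules.PicardGroupThickeningTorsorFlat
import Literature.AlgebraicGeometry.RelativeSpec.GeometricQuotientGroupLaw
import Mathlib.AlgebraicGeometry.Noetherian
import Mathlib.RingTheory.Ideal.KrullsHeightTheorem
import Mathlib.FieldTheory.IsAlgClosed.Basic
import HarnessLib

/-!
# F-3 (Mc) N3′ GREAT-GRANDCHILD LINE `Cruxes/HDel/Lines/F3DualAbelianSchemeMcN3` — the Artinian tower under `stub_McN3`
# LINE EDITION v1 (proposal F0P1c-plan (g0), 2026-08-30 21:5xZ, for the custodian B-p02 (g17) to sign and the 24835 registrar B-plan1 (g19)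
# to `crux write`): = B-p02 (g16)'s SUB-SKELETON v0 d0fcdec9ed97777d BYTE-IDENTICAL except (Δ1) the namespace is this line's own
# `…Cruxes.HypDel.F3DualAbelianSchemeMcN3` (so a closer may import this file next to the grandchild `…F3DualAbelianSchemeMc` v2 49bc8eda,
# whose `stub_McN2b` :115 is re-pasted here token for token and whose `stub_McN3` :184 is this file's head `stub_McN3_holds`, ws-identical)
# and (Δ2) this header.  REGISTERED STUBS (6) = S-a `stub_F3McN3Sa` · S-b `stub_F3McN3Sb` · S-d `stub_F3McN3Sd` · S-e `stub_F3McN3Se`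
# (B-typ04 (g15) STUBMENU-F3McN3-inner v0.1 35e070af verbatim) · S-f `stub_F3McN3Sf` · sibling (N2b′) `stub_McN2b`; glue G1–G4 + head sorry-free.
# (Original sub-skeleton header follows.)  SUB-SKELETON v0 (lead draft, B-p02 (g16), 2026-08-30; an INNER cut recorded on the (Mc) card)

HC_CM is proved only modulo the 7 printed citations until rung 0 closes; nothing in this file is about HC.

WHAT THIS IS.  The grandchild line `Cruxes/HDel/Lines/F3DualAbelianSchemeMc.lean` (skeleton v0 ef3c28a3) has the third-layer stub
(N3′) `stub_McN3` «every `Spec 𝒪_{T′,t}⁄𝔪^{n+1} → T′` factors through the seesaw graph `Γ`» ([MumfordAV1970] §13, the Artinian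
induction, over the residue field of an ARBITRARY point — D3).  This file PROVES `stub_McN3`'s signature VERBATIM (`stub_McN3_holds`, no
`sorry` outside `stub_*`) from
* the four INNER LETTERS S-a `stub_F3McN3Sa`, S-b `stub_F3McN3Sb`, S-d `stub_F3McN3Sd`, S-e `stub_F3McN3Se` typed by B-typ04 (g15)
  (`typers/B-typ04/F3Mc/STUBMENU-F3McN3-inner.v0.1.B-typ04g15.lean` 35e070af, pasted byte-identical; road (R-a′) «slim relative tower
  along principal small extensions», B-plan1 (g19) 20:24:23Z; S-d is consumed inside S-e's proof only),
* the LEVEL-0 letter S-f `stub_F3McN3Sf` = B-p09 (g17)'s HOME-GREEN head `AbelianSchemeOver.exists_graphPoint_residueField`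
  (`GraphPointResidueField.reportfirst.v1` 9eeb66cc) instantiated at `A′ := A.baseChange p` (its `hΘ′` is his
  `exists_isAmple_cechClass_fibre_baseChange`, F6 v3 9a6420f9) — a one-line proof once those files are ★,
* the sibling grandchild stub (N2b′) `stub_McN2b` (B-p16 (g18)), which discharges S-f's uniqueness hypothesis `hinj`,
and the lead's GLUE, all proved here: (G1) graph points pull back along maps of test objects; (G2) the ONE-STEP LEMMA
`graphPoint_step` «graph point at level `C` ⇒ graph point at level `C′`» along a principal small extension `C′ ↠ C` over `S′`
(S-a lift `g₁` ⇒ `(1×g₁)^*𝒫′` and `ℒ_{C′}` both lift `E := ℒ_C` ⇒ S-b defect `t` ⇒ S-e moved lift `g₂` of class `[ℒ_{C′}]` ⇒ ★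
`Modules.nonempty_iso_of_detClassH_eq_add`); (G3) the TOWER `graphPoint_tower`: Noetherian induction on the kernel `K ⊴ 𝒪_{T′,t}` of a
surjection `𝒪_{T′,t} ↠ C′` onto an Artinian local ring (base: `C′` a field ⇒ the point factors through `Spec κ(t)`, S-f + (G1); step: a
socle element `t₀ ∈ C′` (`t₀ ≠ 0`, `t₀𝔪 = 0`) gives the principal small extension `C′ ↠ C′⁄(t₀)` with larger kernel, ★
`Modules.isFirstOrderThickening_of_smallExtension` through ★ `isPullback_whiskerLeft_left`, then (G2)); (G4) `stub_McN3_holds`: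
`𝒪_{T′,t}⁄𝔪^{n+1}` is Artinian local (T′ locally Noetherian: finite type over the finite étale `S′` over the Noetherian `R`), `char κ(t) = 0`
(`ℚ → R → κ(t)`), the tower at `K := 𝔪^{n+1}`, and the graph's functor of points `hΓ` turns the graph point into the factorisation.

## References
* [MumfordAV1970] D. Mumford, *Abelian Varieties* (1970), §13 (Thm. p. 125 and its proof, pp. 125–130).
* [Hartshorne2010] R. Hartshorne, *Deformation Theory* (2010), §6 Thm. 6.4 (a)–(d), Rem. 6.4.1 (pp. 50–51); (6.1) p. 46.
* [Hartshorne1977] R. Hartshorne, *Algebraic Geometry* (1977), Ch. II Prop. 5.9 (p. 116); III Ex. 4.5.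
* [GortzWedhorn2020] U. Görtz, T. Wedhorn, *Algebraic Geometry I*, 2nd ed. (2020), Section (4.7) (pp. 107–108).
* [StacksProject] The Stacks Project, Tags 06GD, 06GE, 00J8.
-/

noncomputable section

open CategoryTheory CategoryTheory.Limits AlgebraicGeometry MonoidalCategory CartesianMonoidalCategory
open scoped MonObj
open Literature.AlgebraicGeometry Literature.AlgebraicGeometry.AbelianSchemes
open Literature.AlgebraicGeometry.Motives Literature.AlgebraicGeometry.AbelianVarieties Literature.AlgebraicGeometry.Modules
open Literature.AlgebraicGeometry.Deformation

namespace Summit.HodgeConjecture.CorCM.Cruxes.HypDel.F3DualAbelianSchemeMcN3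

/-! # PART A — THE INNER LETTERS (B-typ04 (g15) 35e070af, byte-identical) -/


/-! ## S-b — the defect torsor along a principal small extension of the base -/

/-- **S-b `stub_F3McN3Sb` — RANK-ONE LIFTINGS ALONG `A′_C ⊂ A′_{C′}` FORM A TORSOR UNDER `H¹(𝓘)`** (Hartshorne, *Deformation Theory*,
Thm. 6.4 (b)(c)(d) for the flat deformation `A′ ×_{S′} Spec C′ → Spec C′` of the abelian scheme along a principal small extension
`C′ ↠ C` of Artinian local rings over `S′`): if a rank-one `E` on `X = A′_C` lifts to `X′ = A′_{C′}` at all, then for any two rank-one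
liftings `L′`, `L″` there is a UNIQUE `t ∈ H¹(X′, 𝓘)` with `[L″] = [L′] + H¹(truncExp)(t)` in `H¹(X′, 𝒪^*)` (transitive: 6.4 (b); free:
6.4 (d), since `H⁰(𝒪_{A′_κ}) = κ` by Stein, so global units lift). [cite: Hartshorne2010, §6 Thm. 6.4 (b)–(d) and Rem. 6.4.1 (pp. 50–51)] -/
theorem stub_F3McN3Sb : ∀ (R : Type) [CommRing R] [IsNoetherianRing R] [Algebra ℚ R] (A : AbelianSchemeOver (Spec (.of R)))
    {S' : Scheme.{0}} [IsAffine S'] (p : S' ⟶ Spec (.of R)) [IsFinite p] [Etale p] [Surjective p]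
    (C' C : Type) [CommRing C'] [IsLocalRing C'] [IsArtinianRing C'] [CommRing C] [IsLocalRing C] [IsArtinianRing C]
    (q : C' →+* C) (_hq : Function.Surjective q) (t₀ : C') (_hker : RingHom.ker q = Ideal.span {t₀})
    (_htm : ∀ m ∈ IsLocalRing.maximalIdeal C', t₀ * m = 0) (_ht₀m : t₀ ∈ IsLocalRing.maximalIdeal C')
    (c' : Spec (.of C') ⟶ S')
    (ι₀ : Over.mk (Spec.map (CommRingCat.ofHom q) ≫ c') ⟶ Over.mk c') (_hι : ι₀.left = Spec.map (CommRingCat.ofHom q))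
    [IsFirstOrderThickening ((A.baseChange p).X ◁ ι₀).left]
    (E : ((A.baseChange p).X ⊗ Over.mk (Spec.map (CommRingCat.ofHom q) ≫ c')).left.Modules), HasRank E 1 →
    (∃ (L' : ((A.baseChange p).X ⊗ Over.mk c').left.Modules) (_ : HasRank L' 1),
        Nonempty ((Scheme.Modules.pullback ((A.baseChange p).X ◁ ι₀).left).obj L' ≅ E)) →
    ∀ (L' L'' : ((A.baseChange p).X ⊗ Over.mk c').left.Modules) (hL' : HasRank L' 1) (hL'' : HasRank L'' 1),
      Nonempty ((Scheme.Modules.pullback ((A.baseChange p).X ◁ ι₀).left).obj L' ≅ E) →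
      Nonempty ((Scheme.Modules.pullback ((A.baseChange p).X ◁ ι₀).left).obj L'' ≅ E) →
      ∃! t : (idealSheafAb ((A.baseChange p).X ◁ ι₀).left).H 1,
        detClassH (HasRank.isFiniteLocallyFree' hL'') =
          detClassH (HasRank.isFiniteLocallyFree' hL') + Sheaf.H.map (truncExp ((A.baseChange p).X ◁ ι₀).left) 1 t :=
  -- S-b CLOSED BY NAME (edition v1.2, F0P1c-p02 (g0); B-p03 (g20) slot cert ac78f306): the head of ★
  -- `AbelianSchemes/AbelianSchemeSmallExtensionPicardTorsor` (p792187), statement ≡ this letter.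
  Literature.AlgebraicGeometry.AbelianSchemes.AbelianSchemeOver.existsUnique_detClassH_eq_add_truncExp_smallExtension


/-! ## S-a — lifts along the small extension exist (smoothness of `Â′ → S′`) -/

/-- **S-a `stub_F3McN3Sa` — LIFTS EXIST**: `Â′ = hat → S′` is smooth, so every `S′`-morphism `Spec C → Â′` extends along the
nilpotent thickening `Spec C ↪ Spec C′` (formal smoothness; Mathlib `FormallySmooth` lifting ∕ ★ `Morphisms/EtaleLiftDualNumber`
patterns).  The TORSOR structure of the set of lifts (under the derivations of `𝒪_{Â′,y}` into `(t₀)`) is prover-internal to S-d∕S-e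
and is not lettered (no derivation carrier in the letters). [cite: EGAIV4, Prop. 17.1.1 and Déf. 17.3.1 (formally smooth ⇒ infinitesimal lifting)]
[cite: MumfordAV1970, §13 (proof of the Thm. pp. 125–130)] -/
theorem stub_F3McN3Sa : ∀ (R : Type) [CommRing R] [IsNoetherianRing R] [Algebra ℚ R] (A : AbelianSchemeOver (Spec (.of R)))
    {S' : Scheme.{0}} [IsAffine S'] (p : S' ⟶ Spec (.of R)) [IsFinite p] [Etale p] [Surjective p]
    (hat : AbelianSchemeOver S')
    (C' C : Type) [CommRing C'] [IsLocalRing C'] [IsArtinianRing C'] [CommRing C] [IsLocalRing C] [IsArtinianRing C]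
    (q : C' →+* C) (_hq : Function.Surjective q) (t₀ : C') (_hker₀ : RingHom.ker q = Ideal.span {t₀})
    (_htm : ∀ m ∈ IsLocalRing.maximalIdeal C', t₀ * m = 0) (_ht₀m : t₀ ∈ IsLocalRing.maximalIdeal C')
    (c' : Spec (.of C') ⟶ S')
    (ι₀ : Over.mk (Spec.map (CommRingCat.ofHom q) ≫ c') ⟶ Over.mk c') (_hι : ι₀.left = Spec.map (CommRingCat.ofHom q)),
    ∀ g : Over.mk (Spec.map (CommRingCat.ofHom q) ≫ c') ⟶ hat.X, ∃ g' : Over.mk c' ⟶ hat.X, ι₀ ≫ g' = g := by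
  -- S-a CLOSED BY NAME (edition, F0P1c-p02 (g0); body = B-p02 (g17) slot cert 821d11b4) over ★ `Deformation/MorphismLiftsSquareZeroSmoothLocal`.
  intro R _ _ _ _A S' _ p _ _ _ hat C' C _ _ _ _ _ _ q hq t₀ hker₀ htm ht₀m c' ι₀ hι g
  exact Literature.AlgebraicGeometry.Deformation.exists_over_lift_of_smooth_smallExtension hat.X hat.isSmooth C' C q hq
    t₀ hker₀ (htm t₀ ht₀m) c' ι₀ hι g

/-! ## S-d — Kodaira–Spencer INJECTIVE, at the level of lifts -/

/-- **S-d `stub_F3McN3Sd` — KODAIRA–SPENCER INJECTIVITY OF `𝒫′`, LIFT-LEVEL FORM**: two lifts `g₁, g₂ : Spec C′ → Â′` over `S′` of the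
SAME `C`-point (`ι₀ ≫ g₁ = ι₀ ≫ g₂`) whose pulled-back Poincaré bundles `(1 × g₁)^*𝒫′ ≅ (1 × g₂)^*𝒫′` are isomorphic on
`X′ = A′_{C′}` are EQUAL.  Proof road (B-p07 (g20)): the two lifts differ by a derivation `δ` of `𝒪_{Â′,y}` into `(t₀) ≅ κ` (S-a torsor,
`C′ ×_C C′ ≅ C′ ×_κ κ[ε]`), i.e. by a `κ[ε]`-point of `Â′` at `y`; the class difference `[(1×g₂)^*𝒫′] − [(1×g₁)^*𝒫′] ∈ H¹(𝓘)` is the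
Kodaira–Spencer class of that `κ[ε]`-point (⊗ `(t₀)`); it vanishes, so by FIRST-ORDER RIGIDITY (N3d′, B-p07 `firstOrderRigid_of_graphCond`
at `K := κ^alg`, + injectivity of `Der → Der ⊗_κ κ^alg`) the `κ[ε]`-point is constant, `δ = 0`, `g₁ = g₂`.
[cite: MumfordAV1970, §13 (proof of the Thm. pp. 125–130)] [cite: Hartshorne2010, §6 Thm. 6.4 (b) (p. 50)] -/
theorem stub_F3McN3Sd : ∀ (R : Type) [CommRing R] [IsNoetherianRing R] [Algebra ℚ R] (A : AbelianSchemeOver (Spec (.of R)))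
    (L : A.left.Modules) (hL : HasRank L 1)
    (_hε : CechPic.pullback A.unitSection (detClass (HasRank.isFiniteLocallyFree' hL)) = 1)
    (_hΘ : ∀ ⦃Ω : Type⦄ [Field Ω] [IsAlgClosed Ω] (s : Spec (.of Ω) ⟶ Spec (.of R)),
      ∃ Θ : CartierDivisor (A.fibre s).toAbelianVariety.X.left, Θ.IsAmple ∧
        CechPic.pullback (X := (A.fibre s).toAbelianVariety.X.left) (pullback.fst A.X.hom s)
          (detClass (HasRank.isFiniteLocallyFree' hL)) = Θ.cechClass)
    {S' : Scheme.{0}} [IsAffine S'] (p : S' ⟶ Spec (.of R)) [IsFinite p] [Etale p] [Surjective p]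
    (hat : AbelianSchemeOver S') (π : (A.baseChange p).X ⟶ hat.X) [IsMonHom π]
    (_hπ : IsFinite π.left ∧ Etale π.left ∧ Surjective π.left)
    (P : ((A.baseChange p).prodLeft hat).Modules)
    (_hker : ∀ (T : Over S') (u : T ⟶ (A.baseChange p).X),
      u ≫ π = 1 ↔ (A.baseChange p).MemKOfL ((Scheme.Modules.pullback (pullback.fst A.X.hom p)).obj L) u)
    (_h1 : HasRank P 1)
    (_hrig : Nonempty ((Scheme.Modules.pullback ((A.baseChange p).unitSlice hat)).obj P ≅ SheafOfModules.unit _))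
    (_hsock : Nonempty ((Scheme.Modules.pullback ((A.baseChange p).X ◁ π).left).obj P ≅
      (A.baseChange p).mumfordBundle ((Scheme.Modules.pullback (pullback.fst A.X.hom p)).obj L)))
    (C' C : Type) [CommRing C'] [IsLocalRing C'] [IsArtinianRing C'] [CommRing C] [IsLocalRing C] [IsArtinianRing C]
    (q : C' →+* C) (_hq : Function.Surjective q) (t₀ : C') (_hker₀ : RingHom.ker q = Ideal.span {t₀})
    (_htm : ∀ m ∈ IsLocalRing.maximalIdeal C', t₀ * m = 0) (_ht₀m : t₀ ∈ IsLocalRing.maximalIdeal C')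
    (c' : Spec (.of C') ⟶ S')
    (ι₀ : Over.mk (Spec.map (CommRingCat.ofHom q) ≫ c') ⟶ Over.mk c') (_hι : ι₀.left = Spec.map (CommRingCat.ofHom q))
    (g₁ g₂ : Over.mk c' ⟶ hat.X), ι₀ ≫ g₁ = ι₀ ≫ g₂ →
    Nonempty ((Scheme.Modules.pullback ((A.baseChange p).baseChangeToProd hat c' g₁.left (Over.w g₁))).obj P ≅
      (Scheme.Modules.pullback ((A.baseChange p).baseChangeToProd hat c' g₂.left (Over.w g₂))).obj P) →
    g₁ = g₂ := by
  -- S-d CLOSED BY NAME (edition v1.1, F0P1c-p02 (g0); body = B-p07 (g20) SLOT v2) over ★ `AbelianSchemes/PoincareFamilyPointsInjective`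
  -- §3 `eq_of_nonempty_pullback_poincare_iso` + §5 `cechPic_pullback_unitSection_baseChange_eq_one` (p791848).
  intro R _ _ _ A L hL hε _hΘ S' _ p _ _ _ hat π _ hπ P hker _h1 _hrig hsock C' C _ _ _ _ _ _ q _hq t₀ _hker₀ _htm _ht₀m c' ι₀ _hι
    g₁ g₂ _ h
  haveI : Etale π.left := hπ.2.1
  haveI : Surjective π.left := hπ.2.2
  haveI : Flat π.left := inferInstance
  haveI : IsLocallyNoetherian S' := LocallyOfFiniteType.isLocallyNoetherian p
  exact (A.baseChange p).eq_of_nonempty_pullback_poincare_iso hat π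
    (hasRank_pullback (pullback.fst A.X.hom p) hL) (A.cechPic_pullback_unitSection_baseChange_eq_one p hL hε) hker P hsock g₁ g₂ h

/-! ## S-e — Kodaira–Spencer SURJECTIVE, at the level of lifts -/

/-- **S-e `stub_F3McN3Se` — KODAIRA–SPENCER SURJECTIVITY OF `𝒫′`, LIFT-LEVEL FORM**: for a lift `g₁ : Spec C′ → Â′` over `S′` and ANY
class `t ∈ H¹(X′, 𝓘)` there is another lift `g₂` of the same `C`-point with `[(1 × g₂)^*𝒫′] = [(1 × g₁)^*𝒫′] + H¹(truncExp)(t)` — every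
element of the defect torsor (S-b) is realised by moving the lift.  Proof road (B-p07 (g20)): the map «`δ ↦` defect of `g₁ + δ`» from the
derivations of `𝒪_{Â′,y}` into `(t₀)` to `H¹(𝓘)` is `κ`-linear and injective (S-d); both sides have `κ`-dimension `g · dim_κ (t₀) = g`
(`Â′ → S′` smooth of relative dimension `g`; S-c: `H¹(𝓘) ≅ H¹(A′_κ, 𝒪_{A′_κ}) ⊗_κ (t₀)` by flatness, ★ `Deformation.flatSmallExtensionIdealCohomologyEquiv`,
and `dim_κ H¹(A′_κ, 𝒪) = g` = (H1′) B-p07 `finrank_cechH1_structureSheaf_eq_dim_of_charZero` through the Čech↔sheaf dictionary ★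
`Modules/PicardGroupSheafCohomology`), hence surjective.  S-c is INTERNAL to this proof (no separate letter unless the lead wants
`Nonempty (… ≃+ …)` typed). [cite: MumfordAV1970, §13 (proof of the Thm. pp. 125–130)] [cite: GortzWedhorn2023, Prop. 27.122]
[cite: Hartshorne2010, §6 Thm. 6.4 (b) (p. 50)] -/
theorem stub_F3McN3Se : ∀ (R : Type) [CommRing R] [IsNoetherianRing R] [Algebra ℚ R] (A : AbelianSchemeOver (Spec (.of R)))
    (L : A.left.Modules) (hL : HasRank L 1)
    (_hε : CechPic.pullback A.unitSection (detClass (HasRank.isFiniteLocallyFree' hL)) = 1)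
    (_hΘ : ∀ ⦃Ω : Type⦄ [Field Ω] [IsAlgClosed Ω] (s : Spec (.of Ω) ⟶ Spec (.of R)),
      ∃ Θ : CartierDivisor (A.fibre s).toAbelianVariety.X.left, Θ.IsAmple ∧
        CechPic.pullback (X := (A.fibre s).toAbelianVariety.X.left) (pullback.fst A.X.hom s)
          (detClass (HasRank.isFiniteLocallyFree' hL)) = Θ.cechClass)
    {S' : Scheme.{0}} [IsAffine S'] (p : S' ⟶ Spec (.of R)) [IsFinite p] [Etale p] [Surjective p]
    (hat : AbelianSchemeOver S') (π : (A.baseChange p).X ⟶ hat.X) [IsMonHom π]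
    (_hπ : IsFinite π.left ∧ Etale π.left ∧ Surjective π.left)
    (P : ((A.baseChange p).prodLeft hat).Modules)
    (_hker : ∀ (T : Over S') (u : T ⟶ (A.baseChange p).X),
      u ≫ π = 1 ↔ (A.baseChange p).MemKOfL ((Scheme.Modules.pullback (pullback.fst A.X.hom p)).obj L) u)
    (_h1 : HasRank P 1)
    (_hrig : Nonempty ((Scheme.Modules.pullback ((A.baseChange p).unitSlice hat)).obj P ≅ SheafOfModules.unit _))
    (_hsock : Nonempty ((Scheme.Modules.pullback ((A.baseChange p).X ◁ π).left).obj P ≅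
      (A.baseChange p).mumfordBundle ((Scheme.Modules.pullback (pullback.fst A.X.hom p)).obj L)))
    (C' C : Type) [CommRing C'] [IsLocalRing C'] [IsArtinianRing C'] [CommRing C] [IsLocalRing C] [IsArtinianRing C]
    (q : C' →+* C) (_hq : Function.Surjective q) (t₀ : C') (_hker₀ : RingHom.ker q = Ideal.span {t₀})
    (_htm : ∀ m ∈ IsLocalRing.maximalIdeal C', t₀ * m = 0) (_ht₀m : t₀ ∈ IsLocalRing.maximalIdeal C')
    (c' : Spec (.of C') ⟶ S')
    (ι₀ : Over.mk (Spec.map (CommRingCat.ofHom q) ≫ c') ⟶ Over.mk c') (_hι : ι₀.left = Spec.map (CommRingCat.ofHom q))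
    [IsFirstOrderThickening ((A.baseChange p).X ◁ ι₀).left]
    (g₁ : Over.mk c' ⟶ hat.X) (t : (idealSheafAb ((A.baseChange p).X ◁ ι₀).left).H 1),
    ∃ g₂ : Over.mk c' ⟶ hat.X, ι₀ ≫ g₂ = ι₀ ≫ g₁ ∧
      detClassH (HasRank.isFiniteLocallyFree' (hasRank_pullback _ _h1 :
          HasRank (X := ((A.baseChange p).X ⊗ Over.mk c').left) ((Scheme.Modules.pullback ((A.baseChange p).baseChangeToProd hat c' g₂.left (Over.w g₂))).obj P) 1)) =
        detClassH (HasRank.isFiniteLocallyFree' (hasRank_pullback _ _h1 :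
          HasRank (X := ((A.baseChange p).X ⊗ Over.mk c').left) ((Scheme.Modules.pullback ((A.baseChange p).baseChangeToProd hat c' g₁.left (Over.w g₁))).obj P) 1)) +
          Sheaf.H.map (truncExp ((A.baseChange p).X ◁ ι₀).left) 1 t :=
  -- S-e CLOSED BY NAME (edition, F0P1c-p02 (g0); F0P1c-p01 (g0) K5 slot cert 0797c84f) — the head of ★
  -- `AbelianSchemes/PoincareFamilyKSSurjective`, statement ≡ this letter.
  Literature.AlgebraicGeometry.AbelianSchemes.AbelianSchemeOver.exists_lift_detClassH_eq_add_smallExtension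


/-! # PART B — THE SIBLING STUB (N2b′) AND THE LEVEL-0 LETTER S-f -/

/-- **stub (N2b′) `stub_McN2b`** — [MumfordAV1970] §13 (p. 125) «`Â = A/K(L)`»: two GEOMETRIC points `y, y′ : Spec Ω → Â′` over the
same geometric point `x` of `T′` (`Ω` algebraically closed, `s : Spec Ω → S′`; stated for two `Ω`-points `u = (x, y)`, `u′ = (x, y′)` of
`T′ × Â′` with equal first coordinate) which both satisfy the graph condition «`(1 × y)^*𝒫′ ≅ (1 × x)^*ℒ`» coincide: lifting `y = π(a)`, `y′ = π(a′)` through the surjective `π` and reading the SOCKET `_hsock` on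
slices, `t_a^*L′ ⊗ L′⁻¹ ≅ t_{a′}^*L′ ⊗ L′⁻¹`, so `a − a′ ∈ K(L′)` and `y = y′` by the KERNEL clause `_hker` (★ `comp_quotientMk_eq_one_iff`
pattern, ★ `isHomogeneous_pullback_baseChangeToProd_mumfordBundle`, ★ `AbelianSchemeKOfLFibres`).  Hand: B-p16 (g18) (GO 19:48:19Z).
Size S–M.  `GraphCond′` spelled out (D1) at the test object `Over.mk s`.  Why it might fail: only as typed (ALL alg. closed `Ω`, D2(a)).
[cite: MumfordAV1970, §13 Theorem (p. 125) and §8 (p. 77)] -/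
theorem stub_McN2b : ∀ (R : Type) [CommRing R] [IsNoetherianRing R] [Algebra ℚ R] (A : AbelianSchemeOver (Spec (.of R)))
    (L : A.left.Modules) (hL : HasRank L 1)
    {S' : Scheme.{0}} [IsAffine S'] (p : S' ⟶ Spec (.of R)) [IsFinite p] [Etale p]
    (hat : AbelianSchemeOver S') (π : (A.baseChange p).X ⟶ hat.X) [IsMonHom π]
    (_hπ : IsFinite π.left ∧ Etale π.left ∧ Surjective π.left)
    (P : ((A.baseChange p).prodLeft hat).Modules)
    (_hker : ∀ (T : Over S') (u : T ⟶ (A.baseChange p).X),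
      u ≫ π = 1 ↔ (A.baseChange p).MemKOfL ((Scheme.Modules.pullback (pullback.fst A.X.hom p)).obj L) u)
    (_h1 : HasRank P 1)
    (_hsock : Nonempty ((Scheme.Modules.pullback ((A.baseChange p).X ◁ π).left).obj P ≅
      (A.baseChange p).mumfordBundle ((Scheme.Modules.pullback (pullback.fst A.X.hom p)).obj L)))
    (T' : Over S') (ℒ : (A.baseChange p).RigidifiedLineBundle T'.hom) (_hℒ : ℒ.FibrewisePicZero)
    {Ω : Type} [Field Ω] [IsAlgClosed Ω] (s : Spec (.of Ω) ⟶ S') (u u' : Over.mk s ⟶ T' ⊗ hat.X),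
    u ≫ CartesianMonoidalCategory.fst T' hat.X = u' ≫ CartesianMonoidalCategory.fst T' hat.X →
    Nonempty ((Scheme.Modules.pullback ((A.baseChange p).baseChangeToProd hat (Over.mk s).hom
        (u ≫ CartesianMonoidalCategory.snd T' hat.X).left (Over.w (u ≫ CartesianMonoidalCategory.snd T' hat.X)))).obj P ≅
      (Scheme.Modules.pullback ((A.baseChange p).X ◁ (u ≫ CartesianMonoidalCategory.fst T' hat.X)).left).obj ℒ.L) →
    Nonempty ((Scheme.Modules.pullback ((A.baseChange p).baseChangeToProd hat (Over.mk s).hom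
        (u' ≫ CartesianMonoidalCategory.snd T' hat.X).left (Over.w (u' ≫ CartesianMonoidalCategory.snd T' hat.X)))).obj P ≅
      (Scheme.Modules.pullback ((A.baseChange p).X ◁ (u' ≫ CartesianMonoidalCategory.fst T' hat.X)).left).obj ℒ.L) →
    u ≫ CartesianMonoidalCategory.snd T' hat.X = u' ≫ CartesianMonoidalCategory.snd T' hat.X := by
  -- N2b′ CLOSED BY NAME (edition v1.3, F0P1c-p02 (g0); letter RESHAPED `+ (hL : HasRank L 1)` — the joint `(hL)` edition with Mc v2.1c;
  -- body = B-p16 (g18) slot cert 5c7c76b7 verbatim) over ★ `AbelianSchemes/MumfordQuotientSliceInjective` (p792862).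
  intro R _ _ _ A L hL S' _ p _ _ hat π _ hπ P hker _h1 hsock T' ℒ _hℒ Ω _ _ s u u' hfst hu hu'
  haveI : IsFinite π.left := hπ.1
  haveI : Surjective π.left := hπ.2.2
  obtain ⟨eu⟩ := hu
  obtain ⟨eu'⟩ := hu'
  have e : Nonempty ((Scheme.Modules.pullback ((A.baseChange p).baseChangeToProd hat (Over.mk s).hom
        (u ≫ CartesianMonoidalCategory.snd T' hat.X).left (Over.w (u ≫ CartesianMonoidalCategory.snd T' hat.X)))).obj P ≅
      (Scheme.Modules.pullback ((A.baseChange p).baseChangeToProd hat (Over.mk s).hom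
        (u' ≫ CartesianMonoidalCategory.snd T' hat.X).left (Over.w (u' ≫ CartesianMonoidalCategory.snd T' hat.X)))).obj P) :=
    ⟨eu ≪≫ eqToIso (by rw [hfst]) ≪≫ eu'.symm⟩
  exact Over.OverMorphism.ext ((A.baseChange p).eq_of_nonempty_pullback_baseChangeToProd_iso_of_socket hat π P hsock
    (hasRank_pullback _ hL) (fun T v hv => (hker T v).2 hv) s _ _ (Over.w _) (Over.w _) e)


/-- **S-f `stub_F3McN3Sf` — THE LEVEL-0 GRAPH POINT OVER `κ(t)`, for EVERY `t ∈ T′`** = B-p09 (g17)'s HOME-GREEN head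
`AbelianSchemeOver.exists_graphPoint_residueField` (`GraphPointResidueField.reportfirst.v1` 9eeb66cc) instantiated at `A′ := A.baseChange p`,
`L′ := (pr_A)^*L` (its `hΘ′` is his `exists_isAmple_cechClass_fibre_baseChange`, F6 v3 9a6420f9): assuming graph points over geometric points
are UNIQUE (`_hinj`, the clean spelling of the sibling letter N2b′) and `char κ(t) = 0`, there is `y₀ : Spec κ(t) → Â′` over `S′` with
`(1 × y₀)^*𝒫′ ≅ (1 × ι_t)^*ℒ` on `A′_{κ(t)}` (level 0 over `κ(t)^alg` by ★ `exists_graphPoint_of_fibrewisePicZero`, then Galois descent of the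
point and of the isomorphism).  One-line proof once B-p09's files are ★. [cite: MumfordAV1970, §8 Theorem 1 (p. 77) and §13 (proof of the Thm., pp. 125–130)]
[cite: GortzWedhorn2023, Thm. 24.66 (1) (p. 405)] -/
theorem stub_F3McN3Sf : ∀ (R : Type) [CommRing R] [IsNoetherianRing R] [Algebra ℚ R] (A : AbelianSchemeOver (Spec (.of R)))
    (L : A.left.Modules) (hL : HasRank L 1)
    (_hε : CechPic.pullback A.unitSection (detClass (HasRank.isFiniteLocallyFree' hL)) = 1)
    (_hΘ : ∀ ⦃Ω : Type⦄ [Field Ω] [IsAlgClosed Ω] (s : Spec (.of Ω) ⟶ Spec (.of R)),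
      ∃ Θ : CartierDivisor (A.fibre s).toAbelianVariety.X.left, Θ.IsAmple ∧
        CechPic.pullback (X := (A.fibre s).toAbelianVariety.X.left) (pullback.fst A.X.hom s)
          (detClass (HasRank.isFiniteLocallyFree' hL)) = Θ.cechClass)
    {S' : Scheme.{0}} [IsAffine S'] (p : S' ⟶ Spec (.of R)) [IsFinite p] [Etale p] [Surjective p]
    (hat : AbelianSchemeOver S') (π : (A.baseChange p).X ⟶ hat.X) [IsMonHom π]
    (_hπ : IsFinite π.left ∧ Etale π.left ∧ Surjective π.left)
    (P : ((A.baseChange p).prodLeft hat).Modules)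
    (_hker : ∀ (T : Over S') (u : T ⟶ (A.baseChange p).X),
      u ≫ π = 1 ↔ (A.baseChange p).MemKOfL ((Scheme.Modules.pullback (pullback.fst A.X.hom p)).obj L) u)
    (_h1 : HasRank P 1)
    (_hrig : Nonempty ((Scheme.Modules.pullback ((A.baseChange p).unitSlice hat)).obj P ≅ SheafOfModules.unit _))
    (_hsock : Nonempty ((Scheme.Modules.pullback ((A.baseChange p).X ◁ π).left).obj P ≅
      (A.baseChange p).mumfordBundle ((Scheme.Modules.pullback (pullback.fst A.X.hom p)).obj L)))
    (T' : Over S') (ℒ : (A.baseChange p).RigidifiedLineBundle T'.hom) (_hℒ : ℒ.FibrewisePicZero)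
    (_hinj : ∀ ⦃Ω : Type⦄ [Field Ω] [IsAlgClosed Ω] (s : Spec (.of Ω) ⟶ S') (x : Over.mk s ⟶ T') (y y' : Over.mk s ⟶ hat.X),
      Nonempty ((Scheme.Modules.pullback ((A.baseChange p).baseChangeToProd hat s y.left (Over.w y))).obj P ≅
        (Scheme.Modules.pullback ((A.baseChange p).X ◁ x).left).obj ℒ.L) →
      Nonempty ((Scheme.Modules.pullback ((A.baseChange p).baseChangeToProd hat s y'.left (Over.w y'))).obj P ≅
        (Scheme.Modules.pullback ((A.baseChange p).X ◁ x).left).obj ℒ.L) → y = y')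
    (t : T'.left) [CharZero (T'.left.residueField t)],
    ∃ y₀ : Over.mk (T'.left.fromSpecResidueField t ≫ T'.hom) ⟶ hat.X,
      Nonempty ((Scheme.Modules.pullback ((A.baseChange p).baseChangeToProd hat (T'.left.fromSpecResidueField t ≫ T'.hom)
          y₀.left (Over.w y₀))).obj P ≅
        (Scheme.Modules.pullback ((A.baseChange p).X ◁ (Over.homMk (T'.left.fromSpecResidueField t) rfl :
          Over.mk (T'.left.fromSpecResidueField t ≫ T'.hom) ⟶ T')).left).obj ℒ.L) := by
  -- S-f CLOSED BY NAME (edition, F0P1c-p02 (g0); body = B-p09 (g17) closer cert c9fedfa7 tail) over ★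
  -- `AbelianSchemes/GraphPointResidueField` + `AbelianSchemes/GraphPointLevelZero`.
  intro R _ _ _ A L hL _hε _hΘ S' _ p _ _ _ hat π _ _hπ P _hker _h1 _hrig _hsock T' ℒ _hℒ _hinj t _
  exact (A.baseChange p).exists_graphPoint_residueField (hasRank_pullback _ hL)
    (A.exists_isAmple_cechClass_fibre_baseChange hL _hΘ p (hasRank_pullback _ hL)) hat π P _h1 _hsock ℒ _hℒ _hinj t

/-! # PART C — THE LEAD'S GLUE (sorry-free) -/

section Glue

variable {S' : Scheme.{0}} (A' : AbelianSchemeOver S')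

/-- (G0) `(1 × (u ≫ v)) = (1 × u) ≫ (1 × v)` on underlying maps. [cite: GortzWedhorn2020, Section (4.7) (pp. 107–108)] -/
theorem whiskerLeft_comp_left' {U V W : Over S'} (u : U ⟶ V) (v : V ⟶ W) :
    (A'.X ◁ (u ≫ v)).left = (A'.X ◁ u).left ≫ (A'.X ◁ v).left := by
  rw [MonoidalCategory.whiskerLeft_comp, Over.comp_left]

/-- (G1) **Graph points pull back**: if `y` is a graph point for `x` over the test object `Spec C → S′` (`(1 × y)^*𝒫′ ≅ (1 × x)^*ℒ`)
and `b : Spec C₁ → Spec C` is a map of test objects over `S′`, then `b ≫ y` is a graph point for `b ≫ x` (apply `(1 × b)^*`).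
[cite: MumfordAV1970, §13 (proof of the Thm., pp. 125–130)] [cite: GortzWedhorn2020, Section (4.7) (pp. 107–108)] -/
theorem nonempty_graphIso_precomp (hat : AbelianSchemeOver S') (P : (A'.prodLeft hat).Modules) {T' : Over S'}
    (ℒ : A'.RigidifiedLineBundle T'.hom) {Y₁ Y : Scheme.{0}} {s₁ : Y₁ ⟶ S'} {s : Y ⟶ S'} (b : Over.mk s₁ ⟶ Over.mk s)
    (x : Over.mk s ⟶ T') (y : Over.mk s ⟶ hat.X)
    (e : Nonempty ((Scheme.Modules.pullback (A'.baseChangeToProd hat s y.left (Over.w y))).obj P ≅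
      (Scheme.Modules.pullback (A'.X ◁ x).left).obj ℒ.L)) :
    Nonempty ((Scheme.Modules.pullback (A'.baseChangeToProd hat s₁ (b ≫ y).left (Over.w (b ≫ y)))).obj P ≅
      (Scheme.Modules.pullback (A'.X ◁ (b ≫ x)).left).obj ℒ.L) := by
  obtain ⟨e⟩ := e
  have hb : A'.baseChangeToProd hat s y.left (Over.w y) = (A'.X ◁ y).left := A'.baseChangeToProd_eq_whiskerLeft_left hat y
  have hbb : A'.baseChangeToProd hat s₁ (b ≫ y).left (Over.w (b ≫ y)) = (A'.X ◁ b).left ≫ (A'.X ◁ y).left :=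
    (A'.baseChangeToProd_eq_whiskerLeft_left hat (b ≫ y)).trans (whiskerLeft_comp_left' A' b y)
  have hx : (A'.X ◁ b).left ≫ (A'.X ◁ x).left = (A'.X ◁ (b ≫ x)).left := (whiskerLeft_comp_left' A' b x).symm
  exact ⟨(Scheme.Modules.pullbackCongr hbb).app P ≪≫
    ((Scheme.Modules.pullbackComp (A'.X ◁ b).left (A'.X ◁ y).left).app P).symm ≪≫
    (Scheme.Modules.pullback (A'.X ◁ b).left).mapIso ((Scheme.Modules.pullbackCongr hb.symm).app P ≪≫ e) ≪≫
    (Scheme.Modules.pullbackComp (A'.X ◁ b).left (A'.X ◁ x).left).app ℒ.L ≪≫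
    (Scheme.Modules.pullbackCongr hx).app ℒ.L⟩

end Glue

/-- `R/𝔪ⁿ⁺¹` is Artinian for a Noetherian local `(R, 𝔪)` (adapted from ★ `Morphisms/SteinOfArtinLevels`, private there).
[cite: StacksProject, Tag 00J8] -/
private theorem isArtinianRing_quotient_maximalIdeal_pow' {R₀ : Type} [CommRing R₀] [IsNoetherianRing R₀] [IsLocalRing R₀] (n : ℕ) :
    IsArtinianRing (R₀ ⧸ IsLocalRing.maximalIdeal R₀ ^ (n + 1)) := by
  apply IsLocalRing.quotient_artinian_of_mem_minimalPrimes_of_isLocalRing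
  refine ⟨⟨inferInstance, Ideal.pow_le_self (Nat.succ_ne_zero n)⟩, ?_⟩
  rintro q ⟨hq, hle⟩ -
  haveI := hq
  exact (Ideal.IsPrime.pow_le_iff (I := IsLocalRing.maximalIdeal R₀) (P := q) (Nat.succ_ne_zero n)).mp hle

/-- `R/𝔪ⁿ⁺¹` is local (adapted from ★ `Morphisms/SteinOfArtinLevels`, private there). [cite: StacksProject, Tag 00J8] -/
private theorem isLocalRing_quotient_maximalIdeal_pow' {R₀ : Type} [CommRing R₀] [IsLocalRing R₀] (n : ℕ) :
    IsLocalRing (R₀ ⧸ IsLocalRing.maximalIdeal R₀ ^ (n + 1)) := by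
  have hne : IsLocalRing.maximalIdeal R₀ ^ (n + 1) ≠ ⊤ := fun h =>
    (IsLocalRing.maximalIdeal.isMaximal R₀).ne_top
      (top_le_iff.mp (h ▸ Ideal.pow_le_self (Nat.succ_ne_zero n)))
  haveI : Nontrivial (R₀ ⧸ IsLocalRing.maximalIdeal R₀ ^ (n + 1)) := Ideal.Quotient.nontrivial_iff.mpr hne
  exact IsLocalRing.of_surjective' (Ideal.Quotient.mk _) Ideal.Quotient.mk_surjective

/-- **A socle element**: an Artinian local ring which is not a field has `t₀ ≠ 0` in `𝔪` with `t₀ · 𝔪 = 0` (take `t₀ ∈ 𝔪^{N-1} ∖ 0`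
for the least `N` with `𝔪^N = 0`); `C ↠ C⁄(t₀)` is then a principal small extension. [cite: StacksProject, Tag 06GE (proof) and Tag 00J8] -/
private theorem exists_socle_elem (C : Type) [CommRing C] [IsArtinianRing C] [IsLocalRing C]
    (h : IsLocalRing.maximalIdeal C ≠ ⊥) :
    ∃ t₀ : C, t₀ ≠ 0 ∧ t₀ ∈ IsLocalRing.maximalIdeal C ∧ ∀ m ∈ IsLocalRing.maximalIdeal C, t₀ * m = 0 := by
  classical
  have hex : ∃ k : ℕ, IsLocalRing.maximalIdeal C ^ k = ⊥ := by
    obtain ⟨k, hk⟩ := IsArtinianRing.isNilpotent_jacobson_bot (R := C)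
    exact ⟨k, by rwa [IsLocalRing.jacobson_eq_maximalIdeal ⊥ bot_ne_top] at hk⟩
  have hN : IsLocalRing.maximalIdeal C ^ Nat.find hex = ⊥ := Nat.find_spec hex
  have hN0 : Nat.find hex ≠ 0 := by
    intro h0
    have h' := hN
    rw [h0, pow_zero, Ideal.one_eq_top] at h'
    exact top_ne_bot h'
  have hN1 : Nat.find hex ≠ 1 := by
    intro h1
    have h' := hN
    rw [h1, pow_one] at h'
    exact h h'
  have hne : IsLocalRing.maximalIdeal C ^ (Nat.find hex - 1) ≠ ⊥ := Nat.find_min hex (by omega)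
  obtain ⟨t₀, ht₀, ht₀0⟩ := Submodule.exists_mem_ne_zero_of_ne_bot hne
  refine ⟨t₀, ht₀0, Ideal.pow_le_self (by omega) ht₀, fun m hm => ?_⟩
  have hmem : t₀ * m ∈ IsLocalRing.maximalIdeal C ^ (Nat.find hex - 1 + 1) := by
    rw [pow_succ]
    exact Ideal.mul_mem_mul ht₀ hm
  rwa [Nat.sub_add_cancel (by omega), hN, Ideal.mem_bot] at hmem

/-- (G2) **THE ONE-STEP LEMMA** — «graph point at level `C` ⇒ graph point at level `C′`» along a principal small extension `C′ ↠ C` of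
Artinian local rings over `S′`, for a `C′`-valued point `x′` of `T′`: S-a lifts the `C`-level graph point `g` to some `g₁`; the two rank-one
liftings `(1 × g₁)^*𝒫′` and `ℒ_{C′} := (1 × x′)^*ℒ` of `E := ℒ_C` differ by a unique defect `t ∈ H¹(𝓘)` (S-b); S-e moves the lift to
`g₂` with class `[(1 × g₁)^*𝒫′] + t = [ℒ_{C′}]`, and equal classes of liftings give an isomorphism (★ `Modules.nonempty_iso_of_detClassH_eq_add`).
[cite: MumfordAV1970, §13 (proof of the Thm., pp. 125–130)] [cite: Hartshorne2010, §6 Thm. 6.4 (b)–(d) (pp. 50–51)] -/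
theorem graphPoint_step (R : Type) [CommRing R] [IsNoetherianRing R] [Algebra ℚ R] (A : AbelianSchemeOver (Spec (.of R)))
    (L : A.left.Modules) (hL : HasRank L 1)
    (hε : CechPic.pullback A.unitSection (detClass (HasRank.isFiniteLocallyFree' hL)) = 1)
    (hΘ : ∀ ⦃Ω : Type⦄ [Field Ω] [IsAlgClosed Ω] (s : Spec (.of Ω) ⟶ Spec (.of R)),
      ∃ Θ : CartierDivisor (A.fibre s).toAbelianVariety.X.left, Θ.IsAmple ∧
        CechPic.pullback (X := (A.fibre s).toAbelianVariety.X.left) (pullback.fst A.X.hom s)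
          (detClass (HasRank.isFiniteLocallyFree' hL)) = Θ.cechClass)
    {S' : Scheme.{0}} [IsAffine S'] (p : S' ⟶ Spec (.of R)) [IsFinite p] [Etale p] [Surjective p]
    (hat : AbelianSchemeOver S') (π : (A.baseChange p).X ⟶ hat.X) [IsMonHom π]
    (hπ : IsFinite π.left ∧ Etale π.left ∧ Surjective π.left)
    (P : ((A.baseChange p).prodLeft hat).Modules)
    (hker : ∀ (T : Over S') (u : T ⟶ (A.baseChange p).X),
      u ≫ π = 1 ↔ (A.baseChange p).MemKOfL ((Scheme.Modules.pullback (pullback.fst A.X.hom p)).obj L) u)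
    (h1 : HasRank P 1)
    (hrig : Nonempty ((Scheme.Modules.pullback ((A.baseChange p).unitSlice hat)).obj P ≅ SheafOfModules.unit _))
    (hsock : Nonempty ((Scheme.Modules.pullback ((A.baseChange p).X ◁ π).left).obj P ≅
      (A.baseChange p).mumfordBundle ((Scheme.Modules.pullback (pullback.fst A.X.hom p)).obj L)))
    (C' C : Type) [CommRing C'] [IsLocalRing C'] [IsArtinianRing C'] [CommRing C] [IsLocalRing C] [IsArtinianRing C]
    (q : C' →+* C) (hq : Function.Surjective q) (t₀ : C') (hker₀ : RingHom.ker q = Ideal.span {t₀})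
    (htm : ∀ m ∈ IsLocalRing.maximalIdeal C', t₀ * m = 0) (ht₀m : t₀ ∈ IsLocalRing.maximalIdeal C')
    (c' : Spec (.of C') ⟶ S')
    (ι₀ : Over.mk (Spec.map (CommRingCat.ofHom q) ≫ c') ⟶ Over.mk c') (hι : ι₀.left = Spec.map (CommRingCat.ofHom q))
    [IsFirstOrderThickening ((A.baseChange p).X ◁ ι₀).left]
    {T' : Over S'} (ℒ : (A.baseChange p).RigidifiedLineBundle T'.hom)
    (x' : Over.mk c' ⟶ T') (g : Over.mk (Spec.map (CommRingCat.ofHom q) ≫ c') ⟶ hat.X)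
    (hg : Nonempty ((Scheme.Modules.pullback ((A.baseChange p).baseChangeToProd hat (Spec.map (CommRingCat.ofHom q) ≫ c')
        g.left (Over.w g))).obj P ≅
      (Scheme.Modules.pullback ((A.baseChange p).X ◁ (ι₀ ≫ x')).left).obj ℒ.L)) :
    ∃ g' : Over.mk c' ⟶ hat.X, ι₀ ≫ g' = g ∧
      Nonempty ((Scheme.Modules.pullback ((A.baseChange p).baseChangeToProd hat c' g'.left (Over.w g'))).obj P ≅
        (Scheme.Modules.pullback ((A.baseChange p).X ◁ x').left).obj ℒ.L) := by
  -- S-a: a lift `g₁` of `g`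
  obtain ⟨g₁, hg₁⟩ := stub_F3McN3Sa R A p hat C' C q hq t₀ hker₀ htm ht₀m c' ι₀ hι g
  -- the rank-one modules: `M′ = ℒ_{C′}`, `E = ℒ_C = i^*M′`, `L₁ = (1 × g₁)^*𝒫′`
  have hM' : HasRank ((Scheme.Modules.pullback ((A.baseChange p).X ◁ x').left).obj ℒ.L) 1 :=
    hasRank_pullback _ ℒ.hasRank_one
  have hE : HasRank ((Scheme.Modules.pullback ((A.baseChange p).X ◁ ι₀).left).obj
      ((Scheme.Modules.pullback ((A.baseChange p).X ◁ x').left).obj ℒ.L)) 1 :=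
    hasRank_pullback _ hM'
  have hL₁ : HasRank ((Scheme.Modules.pullback ((A.baseChange p).baseChangeToProd hat c' g₁.left (Over.w g₁))).obj P) 1 :=
    hasRank_pullback _ h1
  -- `L₁` lifts `E`
  have e₁ : Nonempty ((Scheme.Modules.pullback ((A.baseChange p).X ◁ ι₀).left).obj
      ((Scheme.Modules.pullback ((A.baseChange p).baseChangeToProd hat c' g₁.left (Over.w g₁))).obj P) ≅
      (Scheme.Modules.pullback ((A.baseChange p).X ◁ ι₀).left).obj
        ((Scheme.Modules.pullback ((A.baseChange p).X ◁ x').left).obj ℒ.L)) := by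
    obtain ⟨e⟩ := hg
    have hb₁ : (A.baseChange p).baseChangeToProd hat c' g₁.left (Over.w g₁) = ((A.baseChange p).X ◁ g₁).left :=
      (A.baseChange p).baseChangeToProd_eq_whiskerLeft_left hat g₁
    have hb : (A.baseChange p).baseChangeToProd hat (Spec.map (CommRingCat.ofHom q) ≫ c') g.left (Over.w g) =
        ((A.baseChange p).X ◁ ι₀).left ≫ ((A.baseChange p).X ◁ g₁).left := by
      rw [← whiskerLeft_comp_left' (A.baseChange p) ι₀ g₁, hg₁]
      exact (A.baseChange p).baseChangeToProd_eq_whiskerLeft_left hat g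
    have hx : ((A.baseChange p).X ◁ ι₀).left ≫ ((A.baseChange p).X ◁ x').left = ((A.baseChange p).X ◁ (ι₀ ≫ x')).left :=
      (whiskerLeft_comp_left' (A.baseChange p) ι₀ x').symm
    exact ⟨(Scheme.Modules.pullback ((A.baseChange p).X ◁ ι₀).left).mapIso ((Scheme.Modules.pullbackCongr hb₁).app P) ≪≫
      (Scheme.Modules.pullbackComp ((A.baseChange p).X ◁ ι₀).left ((A.baseChange p).X ◁ g₁).left).app P ≪≫
      (Scheme.Modules.pullbackCongr hb.symm).app P ≪≫ e ≪≫
      (Scheme.Modules.pullbackCongr hx.symm).app ℒ.L ≪≫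
      ((Scheme.Modules.pullbackComp ((A.baseChange p).X ◁ ι₀).left ((A.baseChange p).X ◁ x').left).app ℒ.L).symm⟩
  -- S-b: the defect `t` of `M′` against `L₁`
  obtain ⟨t, ht, -⟩ := stub_F3McN3Sb R A p C' C q hq t₀ hker₀ htm ht₀m c' ι₀ hι _ hE ⟨_, hL₁, e₁⟩ _ _ hL₁ hM' e₁ ⟨Iso.refl _⟩
  -- S-e: move the lift to realise `t`
  obtain ⟨g₂, hg₂, hc₂⟩ :=
    stub_F3McN3Se R A L hL hε hΘ p hat π hπ P hker h1 hrig hsock C' C q hq t₀ hker₀ htm ht₀m c' ι₀ hι g₁ t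
  refine ⟨g₂, hg₂.trans hg₁, ?_⟩
  exact Modules.nonempty_iso_of_detClassH_eq_add ((A.baseChange p).X ◁ ι₀).left hL₁ (hasRank_pullback _ h1) hM' t hc₂ ht

/-- (G3) **THE TOWER** — Noetherian induction on the kernel `K` of a surjection `ψ : 𝒪_{T′,t} ↠ C′` onto an Artinian local ring: every
`C′`-valued point `x` of `T′` «through `t`» (`x = Spec ψ ≫ (Spec 𝒪_{T′,t} → T′)`) carries a graph point.  Base (`C′` a field): `x` factors
through `Spec κ(t)` and the level-0 graph point (S-f) pulls back (G1).  Step: a socle element `t₀` of `C′` gives the principal small extension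
`C′ ↠ C′⁄(t₀)` (kernel of `𝒪_{T′,t} ↠ C′⁄(t₀)` strictly larger), the induction hypothesis gives a graph point at level `C′⁄(t₀)`, and the
one-step lemma (G2) lifts it (the first-order-thickening instance by ★ `Modules.isFirstOrderThickening_of_smallExtension` through ★
`isPullback_whiskerLeft_left`). [cite: MumfordAV1970, §13 (proof of the Thm., pp. 125–130)] [cite: Hartshorne2010, §6 (6.1) (p. 46) and Thm. 6.4 (pp. 50–51)] -/
theorem graphPoint_tower (R : Type) [CommRing R] [IsNoetherianRing R] [Algebra ℚ R] (A : AbelianSchemeOver (Spec (.of R)))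
    (L : A.left.Modules) (hL : HasRank L 1)
    (hε : CechPic.pullback A.unitSection (detClass (HasRank.isFiniteLocallyFree' hL)) = 1)
    (hΘ : ∀ ⦃Ω : Type⦄ [Field Ω] [IsAlgClosed Ω] (s : Spec (.of Ω) ⟶ Spec (.of R)),
      ∃ Θ : CartierDivisor (A.fibre s).toAbelianVariety.X.left, Θ.IsAmple ∧
        CechPic.pullback (X := (A.fibre s).toAbelianVariety.X.left) (pullback.fst A.X.hom s)
          (detClass (HasRank.isFiniteLocallyFree' hL)) = Θ.cechClass)
    {S' : Scheme.{0}} [IsAffine S'] (p : S' ⟶ Spec (.of R)) [IsFinite p] [Etale p] [Surjective p]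
    (hat : AbelianSchemeOver S') (π : (A.baseChange p).X ⟶ hat.X) [IsMonHom π]
    (hπ : IsFinite π.left ∧ Etale π.left ∧ Surjective π.left)
    (P : ((A.baseChange p).prodLeft hat).Modules)
    (hker : ∀ (T : Over S') (u : T ⟶ (A.baseChange p).X),
      u ≫ π = 1 ↔ (A.baseChange p).MemKOfL ((Scheme.Modules.pullback (pullback.fst A.X.hom p)).obj L) u)
    (h1 : HasRank P 1)
    (hrig : Nonempty ((Scheme.Modules.pullback ((A.baseChange p).unitSlice hat)).obj P ≅ SheafOfModules.unit _))
    (hsock : Nonempty ((Scheme.Modules.pullback ((A.baseChange p).X ◁ π).left).obj P ≅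
      (A.baseChange p).mumfordBundle ((Scheme.Modules.pullback (pullback.fst A.X.hom p)).obj L)))
    (T' : Over S') (ℒ : (A.baseChange p).RigidifiedLineBundle T'.hom) (hℒ : ℒ.FibrewisePicZero)
    (hinj : ∀ ⦃Ω : Type⦄ [Field Ω] [IsAlgClosed Ω] (s : Spec (.of Ω) ⟶ S') (x : Over.mk s ⟶ T') (y y' : Over.mk s ⟶ hat.X),
      Nonempty ((Scheme.Modules.pullback ((A.baseChange p).baseChangeToProd hat s y.left (Over.w y))).obj P ≅
        (Scheme.Modules.pullback ((A.baseChange p).X ◁ x).left).obj ℒ.L) →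
      Nonempty ((Scheme.Modules.pullback ((A.baseChange p).baseChangeToProd hat s y'.left (Over.w y'))).obj P ≅
        (Scheme.Modules.pullback ((A.baseChange p).X ◁ x).left).obj ℒ.L) → y = y')
    (t : T'.left) [CharZero (T'.left.residueField t)] [IsNoetherianRing (T'.left.presheaf.stalk t)] :
    ∀ (K : Ideal (T'.left.presheaf.stalk t)) (C' : Type) [CommRing C'] [IsLocalRing C'] [IsArtinianRing C']
      (ψ : (T'.left.presheaf.stalk t : Type) →+* C') (_ : Function.Surjective ψ) (_ : RingHom.ker ψ = K)
      (s : Spec (.of C') ⟶ S') (x : Over.mk s ⟶ T') (_ : x.left = Spec.map (CommRingCat.ofHom ψ) ≫ T'.left.fromSpecStalk t),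
      ∃ y : Over.mk s ⟶ hat.X,
        Nonempty ((Scheme.Modules.pullback ((A.baseChange p).baseChangeToProd hat s y.left (Over.w y))).obj P ≅
          (Scheme.Modules.pullback ((A.baseChange p).X ◁ x).left).obj ℒ.L) := by
  intro K
  induction K using IsNoetherian.induction with
  | hgt K IH =>
  intro C' _ _ _ ψ hψ hK s x hx
  classical
  by_cases hbot : IsLocalRing.maximalIdeal C' = ⊥
  · /- BASE: `C′` is a field, so `ψ` kills `𝔪_t` and `x` factors through `Spec κ(t)`; pull the level-0 graph point (S-f) back (G1). -/
    haveI := IsLocalHom.of_surjective ψ hψ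
    have H : ∀ a ∈ IsLocalRing.maximalIdeal (T'.left.presheaf.stalk t : Type), ψ a = 0 := fun a ha => by
      have h := map_nonunit ψ a ha
      rwa [hbot, Ideal.mem_bot] at h
    let r : (T'.left.residueField t : Type) →+* C' := Ideal.Quotient.lift _ ψ H
    have hcomp : T'.left.residue t ≫ CommRingCat.ofHom r = CommRingCat.ofHom ψ :=
      CommRingCat.hom_ext (RingHom.ext fun a =>
        Ideal.Quotient.lift_mk (IsLocalRing.maximalIdeal (T'.left.presheaf.stalk t : Type)) ψ H)
    have h2 : Spec.map (CommRingCat.ofHom r) ≫ Spec.map (T'.left.residue t) = Spec.map (CommRingCat.ofHom ψ) := by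
      rw [← Spec.map_comp]
      exact congrArg Spec.map hcomp
    have key : Spec.map (CommRingCat.ofHom r) ≫ T'.left.fromSpecResidueField t = x.left := by
      rw [hx, Scheme.fromSpecResidueField, ← Category.assoc, h2]
    obtain ⟨y₀, hy₀⟩ := stub_F3McN3Sf R A L hL hε hΘ p hat π hπ P hker h1 hrig hsock T' ℒ hℒ hinj t
    let b : Over.mk s ⟶ Over.mk (T'.left.fromSpecResidueField t ≫ T'.hom) :=
      Over.homMk (Spec.map (CommRingCat.ofHom r)) (by
        change Spec.map (CommRingCat.ofHom r) ≫ T'.left.fromSpecResidueField t ≫ T'.hom = s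
        rw [← Category.assoc, key]
        exact Over.w x)
    have hb : b ≫ Over.homMk (T'.left.fromSpecResidueField t) rfl = x := by
      ext
      rw [Over.comp_left]
      exact key
    have h := nonempty_graphIso_precomp (A.baseChange p) hat P ℒ b (Over.homMk (T'.left.fromSpecResidueField t) rfl) y₀ hy₀
    rw [hb] at h
    exact ⟨b ≫ y₀, h⟩
  · /- STEP: a socle element `t₀` of `C′`, the principal small extension `q : C′ ↠ C′⁄(t₀)`, the induction hypothesis at the
    strictly larger kernel, and the one-step lemma (G2). -/
    obtain ⟨t₀, ht0, ht₀m, htm⟩ := exists_socle_elem C' hbot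
    have hne : Ideal.span {t₀} ≠ ⊤ := by
      rw [Ne, Ideal.span_singleton_eq_top]
      exact (IsLocalRing.mem_maximalIdeal _).mp ht₀m
    haveI : Nontrivial (C' ⧸ Ideal.span {t₀}) := Ideal.Quotient.nontrivial_iff.mpr hne
    haveI : IsLocalRing (C' ⧸ Ideal.span {t₀}) :=
      IsLocalRing.of_surjective' (Ideal.Quotient.mk _) Ideal.Quotient.mk_surjective
    have hq : Function.Surjective (Ideal.Quotient.mk (Ideal.span {t₀})) := Ideal.Quotient.mk_surjective
    have hker₀ : RingHom.ker (Ideal.Quotient.mk (Ideal.span {t₀})) = Ideal.span {t₀} := Ideal.mk_ker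
    have hK' : K < RingHom.ker ((Ideal.Quotient.mk (Ideal.span {t₀})).comp ψ) := by
      rw [← hK]
      refine lt_of_le_of_ne (fun a ha => ?_) (fun heq => ht0 ?_)
      · rw [RingHom.mem_ker] at ha ⊢
        rw [RingHom.comp_apply, ha, map_zero]
      · obtain ⟨a, ha⟩ := hψ t₀
        have ha' : a ∈ RingHom.ker ((Ideal.Quotient.mk (Ideal.span {t₀})).comp ψ) := by
          rw [RingHom.mem_ker, RingHom.comp_apply, ha, Ideal.Quotient.eq_zero_iff_mem]
          exact Ideal.mem_span_singleton_self _
        rw [← heq, RingHom.mem_ker, ha] at ha'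
        exact ha'
    let ι₀ : Over.mk (Spec.map (CommRingCat.ofHom (Ideal.Quotient.mk (Ideal.span {t₀}))) ≫ s) ⟶ Over.mk s :=
      Over.homMk (Spec.map (CommRingCat.ofHom (Ideal.Quotient.mk (Ideal.span {t₀})))) rfl
    have hι : ι₀.left = Spec.map (CommRingCat.ofHom (Ideal.Quotient.mk (Ideal.span {t₀}))) := rfl
    obtain ⟨y₁, hy₁⟩ := IH _ hK' (C' ⧸ Ideal.span {t₀}) ((Ideal.Quotient.mk (Ideal.span {t₀})).comp ψ)
      (hq.comp hψ) rfl (Spec.map (CommRingCat.ofHom (Ideal.Quotient.mk (Ideal.span {t₀}))) ≫ s) (ι₀ ≫ x)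
      (by rw [Over.comp_left, hι, hx, CommRingCat.ofHom_comp, Spec.map_comp, Category.assoc]; rfl)
    haveI : IsFirstOrderThickening ((A.baseChange p).X ◁ ι₀).left :=
      Modules.isFirstOrderThickening_of_smallExtension (pullback.snd (A.baseChange p).X.hom s)
        (Ideal.Quotient.mk (Ideal.span {t₀})) hq t₀ hker₀
        (pullback.snd (A.baseChange p).X.hom (Spec.map (CommRingCat.ofHom (Ideal.Quotient.mk (Ideal.span {t₀}))) ≫ s))
        htm ht₀m (RelativeSpec.ActionOver.IsGeometricQuotient.isPullback_whiskerLeft_left ι₀ (A.baseChange p).X).flip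
    obtain ⟨g', -, hg'⟩ := graphPoint_step R A L hL hε hΘ p hat π hπ P hker h1 hrig hsock C' (C' ⧸ Ideal.span {t₀})
      (Ideal.Quotient.mk (Ideal.span {t₀})) hq t₀ hker₀ htm ht₀m s ι₀ hι ℒ x y₁ hy₁
    exact ⟨g', hg'⟩

/-! # PART D — (N3′) FROM THE INNER STUBS -/

/-- **(N3′) `stub_McN3` PROVED from the inner stubs S-a/S-b/S-e (S-d inside S-e), S-f and the sibling N2b′** — the statement is the
grandchild skeleton's `stub_McN3` :176 VERBATIM: for every point `t` of the affine finite-type `T′ → S′` and every `n`, the infinitesimal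
neighbourhood `Spec 𝒪_{T′,t}⁄𝔪^{n+1} → T′` factors through the seesaw graph `Γ`.  Proof: `T′` is locally Noetherian (finite type over the
finite étale `S′` over the Noetherian `R`), so `𝒪_{T′,t}⁄𝔪^{n+1}` is Artinian local; `char κ(t) = 0` (`ℚ → R → κ(t)`); N2b′ in the `lift x y`
spelling gives `hinj`; the tower (G3) at `K := 𝔪^{n+1}`, `ψ := mk` gives a graph point `y`, and the graph's functor of points `hΓ` at the
test object `Spec 𝒪_{T′,t}⁄𝔪^{n+1} → S′` turns `(x, y)` into the factorisation. [cite: MumfordAV1970, §13 (Thm. p. 125 and its proof, pp. 125–130)]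
[cite: Hartshorne1977, Ch. II, Prop. 5.9 (p. 116)] -/
theorem stub_McN3_holds : ∀ (R : Type) [CommRing R] [IsNoetherianRing R] [Algebra ℚ R] (A : AbelianSchemeOver (Spec (.of R)))
    (L : A.left.Modules) (hL : HasRank L 1)
    (_hε : CechPic.pullback A.unitSection (detClass (HasRank.isFiniteLocallyFree' hL)) = 1)
    (_hΘ : ∀ ⦃Ω : Type⦄ [Field Ω] [IsAlgClosed Ω] (s : Spec (.of Ω) ⟶ Spec (.of R)),
      ∃ Θ : CartierDivisor (A.fibre s).toAbelianVariety.X.left, Θ.IsAmple ∧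
        CechPic.pullback (X := (A.fibre s).toAbelianVariety.X.left) (pullback.fst A.X.hom s)
          (detClass (HasRank.isFiniteLocallyFree' hL)) = Θ.cechClass)
    {S' : Scheme.{0}} [IsAffine S'] (p : S' ⟶ Spec (.of R)) [IsFinite p] [Etale p] [Surjective p]
    (hat : AbelianSchemeOver S') (π : (A.baseChange p).X ⟶ hat.X) [IsMonHom π]
    (_hπ : IsFinite π.left ∧ Etale π.left ∧ Surjective π.left)
    (P : ((A.baseChange p).prodLeft hat).Modules)
    (_hker : ∀ (T : Over S') (u : T ⟶ (A.baseChange p).X),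
      u ≫ π = 1 ↔ (A.baseChange p).MemKOfL ((Scheme.Modules.pullback (pullback.fst A.X.hom p)).obj L) u)
    (_h1 : HasRank P 1)
    (_hrig : Nonempty ((Scheme.Modules.pullback ((A.baseChange p).unitSlice hat)).obj P ≅ SheafOfModules.unit _))
    (_hsock : Nonempty ((Scheme.Modules.pullback ((A.baseChange p).X ◁ π).left).obj P ≅
      (A.baseChange p).mumfordBundle ((Scheme.Modules.pullback (pullback.fst A.X.hom p)).obj L)))
    (T' : Over S') [IsAffine T'.left] [LocallyOfFiniteType T'.hom]
    (ℒ : (A.baseChange p).RigidifiedLineBundle T'.hom) (_hℒ : ℒ.FibrewisePicZero)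
    (Γ : Over S') (i : Γ ⟶ T' ⊗ hat.X) [IsClosedImmersion i.left],
    (∀ (S : Over S') (u : S ⟶ T' ⊗ hat.X), (∃ v : S ⟶ Γ, v ≫ i = u) ↔
      Nonempty ((Scheme.Modules.pullback ((A.baseChange p).baseChangeToProd hat S.hom
          (u ≫ CartesianMonoidalCategory.snd T' hat.X).left (Over.w (u ≫ CartesianMonoidalCategory.snd T' hat.X)))).obj P ≅
        (Scheme.Modules.pullback ((A.baseChange p).X ◁ (u ≫ CartesianMonoidalCategory.fst T' hat.X)).left).obj ℒ.L)) →
    ∀ (t : T'.left) (n : ℕ),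
      ∃ g : Spec (.of (↑(T'.left.presheaf.stalk t) ⧸
          IsLocalRing.maximalIdeal ↑(T'.left.presheaf.stalk t) ^ (n + 1))) ⟶ Γ.left,
        g ≫ (i ≫ CartesianMonoidalCategory.fst T' hat.X).left =
          Spec.map (CommRingCat.ofHom (Ideal.Quotient.mk
            (IsLocalRing.maximalIdeal ↑(T'.left.presheaf.stalk t) ^ (n + 1)))) ≫ T'.left.fromSpecStalk t := by
  intro R _ _ _ A L hL hε hΘ S' _ p _ _ _ hat π _ hπ P hker h1 hrig hsock T' _ _ ℒ hℒ Γ i _ hΓ t n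
  classical
  -- `T′` is locally Noetherian
  haveI : IsLocallyNoetherian S' := LocallyOfFiniteType.isLocallyNoetherian p
  haveI : IsLocallyNoetherian T'.left := LocallyOfFiniteType.isLocallyNoetherian T'.hom
  -- `char κ(t) = 0`
  haveI : CharZero (T'.left.residueField t) := by
    have φ₁ : R →+* (Γ(T'.left, ⊤) : Type) :=
      ((T'.hom ≫ p).appTop).hom.comp (Scheme.ΓSpecIso (.of R)).inv.hom
    have φ₂ : (Γ(T'.left, ⊤) : Type) →+* (T'.left.residueField t : Type) :=
      (T'.left.presheaf.germ ⊤ t (TopologicalSpace.Opens.mem_top t) ≫ T'.left.residue t).hom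
    exact charZero_of_injective_ringHom ((φ₂.comp φ₁).comp (algebraMap ℚ R)).injective
  -- N2b′ ⇒ uniqueness of graph points over geometric points
  have hinj : ∀ ⦃Ω : Type⦄ [Field Ω] [IsAlgClosed Ω] (s : Spec (.of Ω) ⟶ S') (x : Over.mk s ⟶ T')
      (y y' : Over.mk s ⟶ hat.X),
      Nonempty ((Scheme.Modules.pullback ((A.baseChange p).baseChangeToProd hat s y.left (Over.w y))).obj P ≅
        (Scheme.Modules.pullback ((A.baseChange p).X ◁ x).left).obj ℒ.L) →
      Nonempty ((Scheme.Modules.pullback ((A.baseChange p).baseChangeToProd hat s y'.left (Over.w y'))).obj P ≅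
        (Scheme.Modules.pullback ((A.baseChange p).X ◁ x).left).obj ℒ.L) → y = y' := by
    intro Ω _ _ s x y y' hy hy'
    have h := stub_McN2b R A L hL p hat π hπ P hker h1 hsock T' ℒ hℒ s (CartesianMonoidalCategory.lift x y)
      (CartesianMonoidalCategory.lift x y')
      (by rw [CartesianMonoidalCategory.lift_fst, CartesianMonoidalCategory.lift_fst])
    rw [CartesianMonoidalCategory.lift_snd, CartesianMonoidalCategory.lift_snd, CartesianMonoidalCategory.lift_fst,
      CartesianMonoidalCategory.lift_fst] at h
    exact h hy hy'
  -- `O := 𝒪_{T′,t} ⁄ 𝔪^{n+1}` is Artinian local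
  haveI := isArtinianRing_quotient_maximalIdeal_pow' (R₀ := (T'.left.presheaf.stalk t : Type)) n
  haveI := isLocalRing_quotient_maximalIdeal_pow' (R₀ := (T'.left.presheaf.stalk t : Type)) n
  -- the tower at `K := 𝔪^{n+1}`, `ψ := mk`
  obtain ⟨y, ⟨e⟩⟩ := graphPoint_tower R A L hL hε hΘ p hat π hπ P hker h1 hrig hsock T' ℒ hℒ hinj t _
    (↑(T'.left.presheaf.stalk t) ⧸ IsLocalRing.maximalIdeal ↑(T'.left.presheaf.stalk t) ^ (n + 1))
    (Ideal.Quotient.mk _) Ideal.Quotient.mk_surjective Ideal.mk_ker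
    ((Spec.map (CommRingCat.ofHom (Ideal.Quotient.mk
        (IsLocalRing.maximalIdeal ↑(T'.left.presheaf.stalk t) ^ (n + 1)))) ≫ T'.left.fromSpecStalk t) ≫ T'.hom)
    (Over.homMk (Spec.map (CommRingCat.ofHom (Ideal.Quotient.mk
        (IsLocalRing.maximalIdeal ↑(T'.left.presheaf.stalk t) ^ (n + 1)))) ≫ T'.left.fromSpecStalk t) rfl) rfl
  -- the graph's functor of points at the test object `Spec O → S′`
  obtain ⟨v, hv⟩ := (hΓ (Over.mk _) (CartesianMonoidalCategory.lift (Over.homMk (Spec.map (CommRingCat.ofHom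
      (Ideal.Quotient.mk (IsLocalRing.maximalIdeal ↑(T'.left.presheaf.stalk t) ^ (n + 1)))) ≫
        T'.left.fromSpecStalk t) rfl) y)).mpr (by
    rw [CartesianMonoidalCategory.lift_snd, CartesianMonoidalCategory.lift_fst]
    exact ⟨e⟩)
  refine ⟨v.left, ?_⟩
  change (v ≫ i ≫ CartesianMonoidalCategory.fst T' hat.X).left = _
  rw [← Category.assoc, hv, CartesianMonoidalCategory.lift_fst]
  rfl

end Summit.HodgeConjecture.CorCM.Cruxes.HypDel.F3DualAbelianSchemeMcN3

end
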